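import Summits.RiemannHypothesis.RiemannHypothesis.Theorems.GroundBartaGroundBartaFloorDefs
import Literature.NumberTheory.LFunctions.XiMomentConcentration
import Mathlib.Analysis.SpecialFunctions.ImproperIntegrals
import Mathlib.MeasureTheory.Integral.ExpDecay
import HarnessLib

/-!
# Decay of the Barta rate `e(a) = 2ϖ_a cosh(a/2)/Φ(a)` (crux GroundBartaFloor, line
`phi_window_supersolution`, stub rateDecay)

For Riemann's kernel `Φ = weilThetaPhi` (`Φ(t) = 2Φ_dB(t/2)`) and the POLAR WEIGHT
`ϖ_a = groundThetaPolarWeight a = ∫_{s>a} Φ(s)·2cosh(s/2) ds` of the even theta vector we prove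

  `e(a) = 2ϖ_a cosh(a/2)/Φ(a) → 0`  (`a → ∞`).

Proof. The matched two-sided comparison `c₀ e^{ψ(u)} ≤ Φ_dB(u) ≤ C₀ e^{ψ(u)}` on `u ≥ 0`
(`ψ(u) = 9u − πe^{4u}`; `deBruijnPhi_ge_exp`, `deBruijnPhi_le_phiUpper`, `c₀ = 2π² − 3π`) gives
`Φ(a) ≥ 2c₀ e^{9a/2 − πe^{2a}}` and, with `2cosh(s/2) ≤ 2e^{s/2}` and the convexity bound
`πe^{2s} ≥ πe^{2a} + 2πe^{2a}(s − a)`, the integrand bound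
`Φ(s)·2cosh(s/2) ≤ 4C₀ e^{5a − πe^{2a}} e^{−(2πe^{2a} − 5)(s − a)}` (`s ≥ a ≥ 0`), whence
`ϖ_a ≤ 4C₀ e^{5a − πe^{2a}}/(2πe^{2a} − 5)` and `0 ≤ e(a) ≤ (4C₀/c₀) cosh(a/2) e^{a/2}/(2πe^{2a} − 5) → 0`.
Elementary; no published source needed beyond the cited comparison (Griffin–Ono–Rolen–Zagier 2019 §4
for the envelope; here taken from the tree).
-/

set_option linter.dupNamespace false

noncomputable section

open Set MeasureTheory Filter
open scoped Real Topology

namespace Summit.RiemannHypothesis.RiemannHypothesis.Theorems.GroundBartaFloor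

open Literature.NumberTheory.LFunctions

/-- `ψ(t/2) = 9t/2 − πe^{2t}` (the de Bruijn exponent in the additive variable `t = 2u`). [folklore] -/
private theorem rateDecay_psi_half (t : ℝ) :
    XiKernel.psi (t / 2) = 9 / 2 * t - π * Real.exp (2 * t) := by
  have e4 : Real.exp (4 * (t / 2)) = Real.exp (2 * t) := by congr 1; ring
  rw [XiKernel.psi, e4]
  ring

/-- **Lower bound of `Φ`**: `Φ(a) ≥ 2(2π² − 3π) e^{9a/2 − πe^{2a}}` for `a ≥ 0` (the first theta term).
[folklore] -/
theorem rateDecay_phi_lower {a : ℝ} (ha : 0 ≤ a) :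
    2 * (2 * π ^ 2 - 3 * π) * Real.exp (9 / 2 * a - π * Real.exp (2 * a)) ≤ weilThetaPhi a := by
  have h := deBruijnPhi_ge_exp (u := a / 2) (by positivity)
  rw [rateDecay_psi_half] at h
  rw [weilThetaPhi_def]
  linarith

/-- **Upper bound of `Φ`**: `Φ(s) ≤ 2C₀ e^{9s/2 − πe^{2s}}` for `s ≥ 0`. [folklore] -/
theorem rateDecay_phi_upper {s : ℝ} (hs : 0 ≤ s) :
    weilThetaPhi s ≤ 2 * phiUpper * Real.exp (9 / 2 * s - π * Real.exp (2 * s)) := by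
  have h := deBruijnPhi_le_phiUpper (u := s / 2) (by positivity)
  rw [rateDecay_psi_half] at h
  rw [weilThetaPhi_def]
  linarith

/-- `2π² − 3π > 0`. [folklore] -/
private theorem rateDecay_c0_pos : 0 < 2 * π ^ 2 - 3 * π := by
  nlinarith [Real.pi_gt_three]

/-- **The integrand bound**: for `0 ≤ a ≤ s`,
`Φ(s)·2cosh(s/2) ≤ 4C₀ e^{5a − πe^{2a}} · e^{−(2πe^{2a} − 5)(s − a)}`. [folklore] -/
theorem rateDecay_integrand_le {a s : ℝ} (ha : 0 ≤ a) (has : a ≤ s) :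
    weilThetaPhi s * (2 * Real.cosh (s / 2)) ≤
      4 * phiUpper * Real.exp (5 * a - π * Real.exp (2 * a)) *
        Real.exp (-(2 * π * Real.exp (2 * a) - 5) * (s - a)) := by
  have hs : 0 ≤ s := ha.trans has
  have hC := phiUpper_pos
  have hΦ := rateDecay_phi_upper hs
  have hcosh : 2 * Real.cosh (s / 2) ≤ 2 * Real.exp (s / 2) := by
    rw [Real.cosh_eq]
    have : Real.exp (-(s / 2)) ≤ Real.exp (s / 2) := Real.exp_le_exp.2 (by linarith)
    linarith
  have hconv : π * Real.exp (2 * a) + 2 * π * Real.exp (2 * a) * (s - a) ≤ π * Real.exp (2 * s) := by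
    have h1 : 1 + 2 * (s - a) ≤ Real.exp (2 * (s - a)) := by
      linarith [Real.add_one_le_exp (2 * (s - a))]
    have h2 : Real.exp (2 * s) = Real.exp (2 * a) * Real.exp (2 * (s - a)) := by
      rw [← Real.exp_add]; congr 1; ring
    have h3 : π * Real.exp (2 * a) * (1 + 2 * (s - a)) ≤ π * Real.exp (2 * a) * Real.exp (2 * (s - a)) :=
      mul_le_mul_of_nonneg_left h1 (by positivity)
    rw [h2, ← mul_assoc]
    linarith
  have hexp : Real.exp (9 / 2 * s - π * Real.exp (2 * s)) * Real.exp (s / 2) ≤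
      Real.exp (5 * a - π * Real.exp (2 * a)) *
        Real.exp (-(2 * π * Real.exp (2 * a) - 5) * (s - a)) := by
    rw [← Real.exp_add, ← Real.exp_add]
    exact Real.exp_le_exp.2 (by linarith)
  calc weilThetaPhi s * (2 * Real.cosh (s / 2))
      ≤ (2 * phiUpper * Real.exp (9 / 2 * s - π * Real.exp (2 * s))) * (2 * Real.exp (s / 2)) :=
        mul_le_mul hΦ hcosh (by positivity) (by positivity)
    _ = 4 * phiUpper * (Real.exp (9 / 2 * s - π * Real.exp (2 * s)) * Real.exp (s / 2)) := by ring
    _ ≤ 4 * phiUpper * (Real.exp (5 * a - π * Real.exp (2 * a)) *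
          Real.exp (-(2 * π * Real.exp (2 * a) - 5) * (s - a))) :=
        mul_le_mul_of_nonneg_left hexp (by positivity)
    _ = _ := by ring

/-- `2πe^{2a} − 5 ≥ πe^{2a} > 0` for `a ≥ 1`. [folklore] -/
private theorem rateDecay_kappa {a : ℝ} (ha : 1 ≤ a) :
    π * Real.exp (2 * a) ≤ 2 * π * Real.exp (2 * a) - 5 ∧ 0 < π * Real.exp (2 * a) := by
  have hE : (1 : ℝ) + 2 ≤ Real.exp (2 * a) := by
    have := Real.add_one_le_exp (2 * a)
    linarith
  have hπ := Real.pi_gt_three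
  constructor
  · nlinarith
  · positivity

/-- **Bound of the polar weight**: `ϖ_a ≤ 4C₀ e^{5a − πe^{2a}}/(πe^{2a})` for `a ≥ 1` (integrate
the integrand bound; `2πe^{2a} − 5 ≥ πe^{2a}`). [folklore] -/
theorem rateDecay_polarWeight_le {a : ℝ} (ha : 1 ≤ a) :
    groundThetaPolarWeight a ≤
      4 * phiUpper * Real.exp (5 * a - π * Real.exp (2 * a)) / (π * Real.exp (2 * a)) := by
  have ha0 : 0 ≤ a := zero_le_one.trans ha
  obtain ⟨hκ1, hκ2⟩ := rateDecay_kappa ha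
  set κ : ℝ := 2 * π * Real.exp (2 * a) - 5 with hκ
  have hκ0 : 0 < κ := lt_of_lt_of_le hκ2 hκ1
  have hC := phiUpper_pos
  set M : ℝ := 4 * phiUpper * Real.exp (5 * a - π * Real.exp (2 * a)) with hM
  have hM0 : 0 ≤ M := by positivity
  clear_value κ M
  -- the exponential majorant: integrable on `(a, ∞)` with integral `M/κ`
  have h1 : ∀ s, M * Real.exp (-κ * (s - a)) = (M * Real.exp (κ * a)) * Real.exp (-κ * s) := by
    intro s
    have e1 : Real.exp (-κ * (s - a)) = Real.exp (κ * a) * Real.exp (-κ * s) := by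
      rw [← Real.exp_add]
      congr 1
      ring
    rw [e1]
    ring
  have hmaj_int : IntegrableOn (fun s => M * Real.exp (-κ * (s - a))) (Ioi a) := by
    simp_rw [h1]
    exact (exp_neg_integrableOn_Ioi a hκ0).const_mul _
  have hmaj_val : ∫ s in Ioi a, M * Real.exp (-κ * (s - a)) = M / κ := by
    simp_rw [h1]
    rw [integral_const_mul, integral_exp_mul_Ioi (neg_lt_zero.2 hκ0) a]
    have e : Real.exp (κ * a) * Real.exp (-κ * a) = 1 := by
      rw [← Real.exp_add, show κ * a + -κ * a = 0 by ring, Real.exp_zero]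
    rw [neg_div_neg_eq, show M * Real.exp (κ * a) * (Real.exp (-κ * a) / κ) =
      M * (Real.exp (κ * a) * Real.exp (-κ * a)) / κ by ring, e, mul_one]
  -- the integrand is dominated by the majorant on `(a, ∞)`
  have hle : ∀ s ∈ Ioi a, weilThetaPhi s * (2 * Real.cosh (s / 2)) ≤ M * Real.exp (-κ * (s - a)) :=
    fun s hs => by rw [hM, hκ]; exact rateDecay_integrand_le ha0 (le_of_lt hs)
  have hcont : Continuous fun s => weilThetaPhi s * (2 * Real.cosh (s / 2)) :=
    continuous_weilThetaPhi.mul (continuous_const.mul (Real.continuous_cosh.comp (continuous_id.div_const _)))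
  have hf_int : IntegrableOn (fun s => weilThetaPhi s * (2 * Real.cosh (s / 2))) (Ioi a) := by
    refine hmaj_int.mono' hcont.aestronglyMeasurable
      (ae_restrict_of_forall_mem measurableSet_Ioi fun s hs => ?_)
    rw [Real.norm_eq_abs, abs_of_nonneg (mul_nonneg (weilThetaPhi_pos s).le
      (mul_nonneg zero_le_two (Real.cosh_pos _).le))]
    exact hle s hs
  calc groundThetaPolarWeight a = ∫ s in Ioi a, weilThetaPhi s * (2 * Real.cosh (s / 2)) := rfl
    _ ≤ ∫ s in Ioi a, M * Real.exp (-κ * (s - a)) :=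
        setIntegral_mono_on hf_int hmaj_int measurableSet_Ioi hle
    _ = M / κ := hmaj_val
    _ ≤ M / (π * Real.exp (2 * a)) := div_le_div_of_nonneg_left hM0 hκ2 hκ1

/-- **Explicit bound of the Barta rate**: `0 ≤ e(a) ≤ (4C₀/(π c₀)) e^{−a}` for `a ≥ 1`
(`c₀ = 2π² − 3π`). [folklore] -/
theorem rateDecay_rate_le {a : ℝ} (ha : 1 ≤ a) :
    2 * groundThetaPolarWeight a * Real.cosh (a / 2) / weilThetaPhi a ≤
      4 * phiUpper / (π * (2 * π ^ 2 - 3 * π)) * Real.exp (-a) := by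
  have ha0 : 0 ≤ a := zero_le_one.trans ha
  have hC := phiUpper_pos
  have hc0 := rateDecay_c0_pos
  have hπ := Real.pi_pos
  have hΦ : 0 < weilThetaPhi a := weilThetaPhi_pos a
  have hlow := rateDecay_phi_lower ha0
  have hϖ := rateDecay_polarWeight_le ha
  have hϖ0 : 0 ≤ groundThetaPolarWeight a :=
    setIntegral_nonneg measurableSet_Ioi fun s _ =>
      mul_nonneg (weilThetaPhi_pos s).le (mul_nonneg zero_le_two (Real.cosh_pos _).le)
  have hcosh : Real.cosh (a / 2) ≤ Real.exp (a / 2) := by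
    rw [Real.cosh_eq]
    have : Real.exp (-(a / 2)) ≤ Real.exp (a / 2) := Real.exp_le_exp.2 (by linarith)
    linarith
  have hcosh0 : 0 < Real.cosh (a / 2) := Real.cosh_pos _
  -- exponent bookkeeping, then freeze the exponentials as atoms
  have hexp : Real.exp (5 * a - π * Real.exp (2 * a)) * Real.exp (a / 2) =
      Real.exp (-a) * Real.exp (2 * a) * Real.exp (9 / 2 * a - π * Real.exp (2 * a)) := by
    rw [← Real.exp_add, ← Real.exp_add, ← Real.exp_add]
    congr 1
    ring
  set E5 : ℝ := Real.exp (5 * a - π * Real.exp (2 * a)) with hE5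
  set E9 : ℝ := Real.exp (9 / 2 * a - π * Real.exp (2 * a)) with hE9
  set Eh : ℝ := Real.exp (a / 2) with hEh
  set Em : ℝ := Real.exp (-a) with hEm
  set E2 : ℝ := Real.exp (2 * a) with hE2
  set c0 : ℝ := 2 * π ^ 2 - 3 * π with hc0def
  have hE2pos : 0 < E2 := Real.exp_pos _
  have hEmpos : 0 < Em := Real.exp_pos _
  -- `2 ϖ cosh(a/2) ≤ 2 · [4C₀ E5/(π E2)] · Eh = (4C₀/(π c₀)) Em · (2 c₀ E9) ≤ (4C₀/(π c₀)) Em · Φ(a)`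
  rw [div_le_iff₀ hΦ]
  calc 2 * groundThetaPolarWeight a * Real.cosh (a / 2)
      ≤ 2 * (4 * phiUpper * E5 / (π * E2)) * Eh :=
        mul_le_mul (mul_le_mul_of_nonneg_left hϖ zero_le_two) hcosh hcosh0.le (by positivity)
    _ = 4 * phiUpper / (π * c0) * Em * (2 * c0 * E9) := by
        field_simp
        linear_combination hexp
    _ ≤ 4 * phiUpper / (π * c0) * Em * weilThetaPhi a :=
        mul_le_mul_of_nonneg_left hlow (by positivity)

/-- **Stub `rateDecay`**: the Barta rate `e(a) = 2ϖ_a cosh(a/2)/Φ(a)` tends to `0` as `a → ∞`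
(squeezed between `0` and `K e^{−a}`). [folklore] -/
theorem stub_groundRateDecay :
    Tendsto (fun a : ℝ => 2 * groundThetaPolarWeight a * Real.cosh (a / 2) / weilThetaPhi a)
      atTop (𝓝 0) := by
  have hK : Tendsto (fun a : ℝ => 4 * phiUpper / (π * (2 * π ^ 2 - 3 * π)) * Real.exp (-a))
      atTop (𝓝 0) := by
    have h := (Real.tendsto_exp_atBot.comp tendsto_neg_atTop_atBot).const_mul
      (4 * phiUpper / (π * (2 * π ^ 2 - 3 * π)))
    rw [mul_zero] at h
    exact h
  refine tendsto_of_tendsto_of_tendsto_of_le_of_le' tendsto_const_nhds hK ?_ ?_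
  · filter_upwards with a
    have hϖ0 : 0 ≤ groundThetaPolarWeight a :=
      setIntegral_nonneg measurableSet_Ioi fun s _ =>
        mul_nonneg (weilThetaPhi_pos s).le (mul_nonneg zero_le_two (Real.cosh_pos _).le)
    exact div_nonneg (mul_nonneg (mul_nonneg zero_le_two hϖ0) (Real.cosh_pos _).le)
      (weilThetaPhi_pos a).le
  · filter_upwards [eventually_ge_atTop (1 : ℝ)] with a ha
    exact rateDecay_rate_le ha

/-- The same statement with the polar weight `ϖ_a = ∫_{s>a} Φ(s)·2cosh(s/2) ds` inlined (this is the
registered stub `stub_bartaRateDecay` of the sibling line `outer_cutoff_harmonic_pairing` of the same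
crux, which needs the same rate). [folklore] -/
theorem stub_bartaRateDecay :
    Tendsto (fun a : ℝ => 2 * (∫ s in Ioi a, weilThetaPhi s * (2 * Real.cosh (s / 2))) *
      Real.cosh (a / 2) / weilThetaPhi a) atTop (𝓝 0) :=
  stub_groundRateDecay

end Summit.RiemannHypothesis.RiemannHypothesis.Theorems.GroundBartaFloor

end
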